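import Mathlib.CategoryTheory.Limits.Preserves.Shapes.BinaryProducts
import Mathlib.CategoryTheory.Limits.Preserves.Shapes.Products
import Mathlib.CategoryTheory.Limits.Preserves.Shapes.Terminal
import Mathlib.CategoryTheory.Adjunction.Limits
import Mathlib.CategoryTheory.Functor.EpiMono
import Literature.AlgebraicGeometry.Frobenioids.Categories
import Literature.AlgebraicGeometry.Frobenioids.CoproductCompletionConnected
import HarnessLib

/-!
# Semi-graphs of anabelioids, §3, Remark 3.1.5 — transport layer: "almost totally epimorphic" and
# "of countably connected type" are invariant under equivalence of categories

Mochizuki, *Semi-graphs of anabelioids*, Publ. RIMS **42** (2006), §3, Remark 3.1.5 (manuscript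
p. 34) [cite: MochizukiSemiAnbd2006, Rmk 3.1.5 p.34]: "every temperoid is an almost totally epimorphic
category of countably connected type [cf. §0]".  A temperoid is, by Definition 3.1 (ii) as typed in
`Temperoids.lean` (abc-iut-L3-t2), a category EQUIVALENT to a countable product of categories
`B^temp(Πᵢ)`; the two properties ([FrdI] §0 p. 15, `IsAlmostTotallyEpimorphic`,
`IsOfCountablyConnectedType` of `Literature.AlgebraicGeometry.Frobenioids.Categories`) are phrased by
initial objects, binary-cofan colimits, epimorphisms, countable coproducts and `Hom`-set bijections,
all of which are transported along an equivalence.  This proof-only file (no definitions) is that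
transport step of the discharge of the named fact `TemperoidAlmostTotallyEpimorphic`; the
`B^temp(Π)`-level facts and the countable-product layer are separate files.  Nothing here is specific
to temperoids; nothing takes a side on [IUTchIII] Cor. 3.12.
-/

namespace Literature.AnabelianGeometry.SemiGraphs

namespace TemperoidTransport

open CategoryTheory CategoryTheory.Limits
open Literature.AlgebraicGeometry.Frobenioids

universe v v' u u'

variable {C : Type u} [Category.{v} C] {D : Type u'} [Category.{v'} D]

/-- Non-initiality descends along an equivalence. [cite: MochizukiFrdI2008, §0 p.15] -/
theorem isNonemptyObj_of_functor (e : C ≌ D) {A : C} (h : IsNonemptyObj (e.functor.obj A)) :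
    IsNonemptyObj A :=
  ⟨fun hA => h.false (hA.isInitialObj e.functor A)⟩

/-- Non-initiality is preserved by an equivalence. [cite: MochizukiFrdI2008, §0 p.15] -/
theorem isNonemptyObj_functor_obj (e : C ≌ D) {A : C} (h : IsNonemptyObj A) :
    IsNonemptyObj (e.functor.obj A) :=
  ⟨fun hA => h.false ((hA.isInitialObj e.inverse _).ofIso (e.unitIso.app A).symm)⟩

/-- Connectedness ([FrdI] §0: non-initial, and not a coproduct of two non-initial objects) descends
along an equivalence. [cite: MochizukiFrdI2008, §0 p.15] -/
theorem isConnectedObj_of_functor (e : C ≌ D) {A : C} (h : IsConnectedObj (e.functor.obj A)) :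
    IsConnectedObj A := by
  refine ⟨isNonemptyObj_of_functor e h.1, fun B₁ B₂ ι₁ ι₂ hB₁ hB₂ => ⟨fun hc => ?_⟩⟩
  have hc' : IsColimit (BinaryCofan.mk (e.functor.map ι₁) (e.functor.map ι₂)) :=
    isColimitMapCoconeBinaryCofanEquiv e.functor ι₁ ι₂ (isColimitOfPreserves e.functor hc)
  exact (h.2 _ _ _ _ (isNonemptyObj_functor_obj e hB₁) (isNonemptyObj_functor_obj e hB₂)).false hc'

/-- Connectedness is preserved by an equivalence. [cite: MochizukiFrdI2008, §0 p.15] -/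
theorem isConnectedObj_functor_obj (e : C ≌ D) {A : C} (h : IsConnectedObj A) :
    IsConnectedObj (e.functor.obj A) :=
  isConnectedObj_of_functor e.symm (h.of_iso (e.unitIso.app A))

/-- **"Almost totally epimorphic" is invariant under equivalence of categories.**
[cite: MochizukiFrdI2008, §0 p.15] -/
theorem isAlmostTotallyEpimorphic_of_equivalence (e : C ≌ D) (h : IsAlmostTotallyEpimorphic D) :
    IsAlmostTotallyEpimorphic C :=
  ⟨fun f hA hB => e.functor.epi_of_epi_map
    (h.epi (e.functor.map f) (isNonemptyObj_functor_obj e hA) (isConnectedObj_functor_obj e hB))⟩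

/-- A colimit cofan stays a colimit cofan after rebuilding it from its point and injections.
[folklore] -/
private def isColimitCofanMk {ι : Type*} {X : ι → C} (c : Cofan X) (hc : IsColimit c) :
    IsColimit (Cofan.mk c.pt c.inj) :=
  hc.ofIsoColimit (Cocone.ext (Iso.refl _) (by rintro ⟨j⟩; exact Category.comp_id _))

/-- The image of a colimit cofan under an equivalence is a colimit cofan. [folklore] -/
private noncomputable def isColimitCofanMap (e : C ≌ D) {ι : Type*} {X : ι → C} (c : Cofan X)
    (hc : IsColimit c) :
    IsColimit (Cofan.mk (e.functor.obj c.pt) fun j => e.functor.map (c.inj j) :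
      Cofan fun j => e.functor.obj (X j)) :=
  isColimitCofanMkObjOfIsColimit e.functor X c.inj (isColimitCofanMk c hc)

/-- **"Of countably connected type" is invariant under equivalence of categories.**
[cite: MochizukiFrdI2008, §0 p.15] -/
theorem isOfCountablyConnectedType_of_equivalence (e : C ≌ D) (h : IsOfCountablyConnectedType D) :
    IsOfCountablyConnectedType C where
  hasCountableCoproducts := ⟨fun J _ => by
    haveI := h.hasCountableCoproducts.out J
    exact Adjunction.hasColimitsOfShape_of_equivalence e.functor⟩
  exists_cofan A := by
    obtain ⟨ι, hι, X, hX, c, ⟨hc⟩, ⟨i⟩⟩ := h.exists_cofan (e.functor.obj A)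
    refine ⟨ι, hι, fun j => e.inverse.obj (X j), fun j => isConnectedObj_functor_obj e.symm (hX j),
      Cofan.mk (e.inverse.obj c.pt) fun j => e.inverse.map (c.inj j), ⟨isColimitCofanMap e.symm c hc⟩,
      ⟨e.inverse.mapIso i ≪≫ (e.unitIso.app A).symm⟩⟩
  bijective {ι} _ {X} c hc B hB := by
    -- transport the bijection for the image cofan in `D` back along the `Hom`-set bijections of `e`
    have hD := h.bijective (Cofan.mk (e.functor.obj c.pt) fun j => e.functor.map (c.inj j))
      (isColimitCofanMap e c hc) (e.functor.obj B) (isConnectedObj_functor_obj e hB)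
    let eB : (B ⟶ c.pt) ≃ (e.functor.obj B ⟶ e.functor.obj c.pt) :=
      e.fullyFaithfulFunctor.homEquiv
    let σ : (Σ j, (B ⟶ X j)) ≃ (Σ j, (e.functor.obj B ⟶ e.functor.obj (X j))) :=
      Equiv.sigmaCongrRight fun j => e.fullyFaithfulFunctor.homEquiv
    have hcomp : (fun p : Σ j, (B ⟶ X j) => p.2 ≫ c.inj p.1) =
        eB.symm ∘ (fun p : Σ j, (e.functor.obj B ⟶ e.functor.obj (X j)) =>
          p.2 ≫ (Cofan.mk (e.functor.obj c.pt) fun j => e.functor.map (c.inj j)).inj p.1) ∘ σ := by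
      funext p
      apply eB.injective
      simp only [Function.comp_apply, Equiv.apply_symm_apply]
      change e.functor.map (p.2 ≫ c.inj p.1) = e.functor.map p.2 ≫ e.functor.map (c.inj p.1)
      exact e.functor.map_comp _ _
    rw [hcomp]
    exact eB.symm.bijective.comp (hD.comp σ.bijective)

end TemperoidTransport

end Literature.AnabelianGeometry.SemiGraphs
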